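import Literature.AlgebraicGeometry.HodgeTheory.MotivatedClassesHodgeConjecture
import Literature.AlgebraicGeometry.HodgeTheory.AlgebraicClassesPullbackHolds
import Literature.AlgebraicGeometry.HodgeTheory.LefschetzStandardOfHodgeConjectureSquare
import Literature.AlgebraicGeometry.Motives.SegreEmbedding
import Summits.HodgeConjecture.HodgeConjecture.Statement
import HarnessLib

/-!
# The summit as a conjunction of two named conjectures: `HodgeConjecture ⟺ (Hodge classes are motivated) ∧ B`

Solo-blind residency on `HodgeConjecture`, session s172; claims SB-C1333 – SB-C1335 of its
`CLAIMS.jsonl`, companion prose `work/s172/middle.md` §2, front sheet `paper/sharpest.md` §1 (1f).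

A KERNEL COROLLARY of theorems already in the tree, recorded at summit level. Two statements, each
a famous open conjecture implied by the Hodge conjecture:

* `HodgeIsMotivated` — André's motivated form of the Hodge conjecture: every rational `(p,p)`-class
  on every smooth projective complex variety lies in André's space `A_motᵖ(X)_ℂ` of motivated classes
  (André 1996, §2.1 Déf. 1; proved by André for abelian varieties, Thm. 0.6.2, and implied by the
  Hodge conjecture variety by variety since algebraic classes are motivated, §2.1 p. 14).
* `LefschetzStandard` — Grothendieck's standard conjecture of Lefschetz type `B(X)` for every smooth
  projective complex `X`, in André's `*_L`-form (`StandardConjectureBStar`: the Lefschetz involution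
  of every polarisation is an algebraic correspondence; Grothendieck 1968 §3; André 1996 §0.3, Prop. 1.2).

Theorems:

* `lefschetzStandard_of_hodgeConjecture` : `HodgeConjecture → LefschetzStandard` — the Hodge
  conjecture for `X × X` makes `*_L` algebraic (Kleiman 1968 §2; in the tree
  `standardConjectureBStar_of_hodgeConjectureFor_prod`, with `X × X` smooth projective by
  `IsSmoothProjective.tensor_holds`).
* `hodgeIsMotivated_of_hodgeConjecture` : `HodgeConjecture → HodgeIsMotivated` (the tree's
  `motivated_of_hodgeConjectureFor`).
* `hodgeConjectureFor_iff_motivated_of_lefschetzStandard` : under `LefschetzStandard`, for each smooth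
  projective `X` separately, `HodgeConjectureFor n X ↔` every rational `(p,p)`-class of `X` is
  motivated (André 1996 §0.3: under `B` for all objects of `𝒱`, motivated cycles reduce to algebraic
  cycles; in the tree `Andre1996_motivatedClasses_le_algebraicClasses_of_standardConjectureB_holds_of`,
  the multiplicativity of algebraic classes being the theorem `Voisin2003_cupProduct_algebraicClasses_holds'`).
* `hodgeConjecture_iff_hodgeIsMotivated_and_lefschetzStandard` :
  **`HodgeConjecture ↔ HodgeIsMotivated ∧ LefschetzStandard`.**

What it buys for the residency's front sheet (prose in `work/s172/middle.md` §2): the summit is the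
conjunction of a statement that is a THEOREM on abelian varieties (André, Thm. 0.6.2) — so that on
abelian varieties the Hodge conjecture is reduced to `B` for total spaces of compact pencils of abelian
varieties (André 1996, §6.3 Remarque 2) — and Grothendieck's `B`, which is known for abelian varieties
(Lieberman 1968) but enters through auxiliary varieties. Neither conjunct is the summit in disguise on
the record: `B` holds for abelian varieties where the Hodge conjecture is open, and `HodgeIsMotivated`
holds for abelian varieties (André) where the Hodge conjecture is open.

## References

* [Andre1996Motifs] Y. André, Pour une théorie inconditionnelle des motifs, Publ. Math. IHÉS 83
  (1996) 5–49: §0.3 (pp. 7–8), §2.1 Déf. 1 and the remark following it (p. 14), Thm. 0.6.2 (p. 9),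
  §6.3 Remarque 2 (p. 33).
* [Grothendieck1968] A. Grothendieck, Standard conjectures on algebraic cycles, Bombay 1968, §3.
* [Kleiman1968AlgebraicCycles] S. Kleiman, Algebraic cycles and the Weil conjectures (1968), §2.
* [Lieberman1968] D. Lieberman, Numerical and homological equivalence of algebraic cycles on Hodge
  manifolds, Amer. J. Math. 90 (1968).
* [Deligne2000] P. Deligne, The Hodge conjecture (2000), §1.
-/

noncomputable section

open CategoryTheory MonoidalCategory
open Literature.AlgebraicGeometry Literature.AlgebraicGeometry.Motives
open Literature.AlgebraicGeometry.HodgeTheory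
open Literature.AlgebraicTopology.SingularHomology

namespace Summit.HodgeConjecture.HodgeConjecture.Theorems.SoloBlind

/-- **André's motivated Hodge conjecture**: every rational class of Hodge type `(p,p)` on every smooth
projective complex variety `X` of dimension `n` lies in the space `A_motᵖ(X)_ℂ` of motivated classes
(`motivatedClasses n X p`). Proved for abelian varieties (André 1996, Thm. 0.6.2); implied by the
Hodge conjecture (`hodgeIsMotivated_of_hodgeConjecture`).
[cite: Andre1996Motifs, §2.1 Déf. 1 (p. 14) and Thm. 0.6.2 (p. 9)] -/
@[conjecture] def HodgeIsMotivated : Prop :=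
  ∀ ⦃n : ℕ⦄ ⦃X : SchemeOver ℂ⦄, IsSmoothProjective n X →
    ∀ (p : ℕ) (c : complexBetti X (2 * p)), IsRationalClass c → IsOfHodgeType n X (2 * p) p p c →
      c ∈ motivatedClasses n X p

/-- **Grothendieck's standard conjecture of Lefschetz type, for all smooth projective complex
varieties**, in André's `*_L`-form: for every smooth projective `Z` of dimension `d` and every
`η ∈ H²(Z(ℂ); ℂ)`, `StandardConjectureBStar d Z η` (for a polarisation class `η`, every Lefschetz
involution `*_L : Hᵃ → Hᵇ`, `a + b = 2d`, is induced by an algebraic correspondence).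
[cite: Grothendieck1968, §3 p. 196 (B(X))] [cite: Andre1996Motifs, §0.3 (pp. 7–8) and Prop. 1.2 (p. 11)] -/
@[conjecture] def LefschetzStandard : Prop :=
  ∀ (d : ℕ) (Z : SchemeOver ℂ) (η : complexBetti Z 2), IsSmoothProjective d Z →
    StandardConjectureBStar d Z η

/-- **`HC ⟹ B`** (Kleiman 1968 §2; Lefschetz): the Hodge conjecture for `Z × Z` makes every Lefschetz
involution of `Z` an algebraic correspondence. In the tree:
`standardConjectureBStar_of_hodgeConjectureFor_prod`, the product `Z ⊗ Z` being smooth projective of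
dimension `d + d` by `IsSmoothProjective.tensor_holds` (Segre).
[cite: Kleiman1968AlgebraicCycles, §2] [cite: Andre1996Motifs, §2.1 remark following Déf. 1 (p. 14)] -/
theorem lefschetzStandard_of_hodgeConjecture (h : _root_.HodgeConjecture) : LefschetzStandard :=
  fun _ _ η hZ =>
    standardConjectureBStar_of_hodgeConjectureFor_prod hZ (h (IsSmoothProjective.tensor_holds hZ hZ)) η

/-- **`HC ⟹` Hodge classes are motivated** ("il est clair que `A_mot(X)` contient `A(X)`", André
1996 §2.1 p. 14; in the tree `motivated_of_hodgeConjectureFor`, unconditional).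
[cite: Andre1996Motifs, §2.1 remark following Déf. 1 (p. 14)] -/
theorem hodgeIsMotivated_of_hodgeConjecture (h : _root_.HodgeConjecture) : HodgeIsMotivated :=
  fun _ _ hX p c hc hpp => motivated_of_hodgeConjectureFor hX (h hX) p c hc hpp

/-- **Under `B` for all varieties, the Hodge conjecture for ONE variety `X` is the statement that
its Hodge classes are motivated** (André 1996 §0.3: motivated cycles reduce to algebraic cycles if
`*_L` is an algebraic correspondence for every object of `𝒱`; the auxiliary varieties `Y` of the
definition of `A_mot(X)` are why `B` is needed for all `Z`, not for `X` alone). In the tree: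
`Andre1996_motivatedClasses_le_algebraicClasses_of_standardConjectureB_holds_of` fed with the theorem
`Voisin2003_cupProduct_algebraicClasses_holds'`; Hodge models by `nonempty_hodgeModel_holds`.
[cite: Andre1996Motifs, §0.3 (pp. 7–8) and §2.1 remark following Déf. 1 (p. 14)] -/
theorem hodgeConjectureFor_iff_motivated_of_lefschetzStandard (hB : LefschetzStandard)
    {n : ℕ} {X : SchemeOver ℂ} (hX : IsSmoothProjective n X) :
    HodgeConjectureFor n X ↔
      ∀ (p : ℕ) (c : complexBetti X (2 * p)), IsRationalClass c → IsOfHodgeType n X (2 * p) p p c →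
        c ∈ motivatedClasses n X p :=
  ⟨fun h p c hc hpp => motivated_of_hodgeConjectureFor hX h p c hc hpp,
    fun hM => ⟨nonempty_hodgeModel_holds hX, fun p c hc hpp =>
      Andre1996_motivatedClasses_le_algebraicClasses_of_standardConjectureB_holds_of
        Voisin2003_cupProduct_algebraicClasses_holds' hB hX p (hM p c hc hpp)⟩⟩

/-- **`(Hodge classes motivated) ∧ B ⟹ HC`** (André 1996 §0.3–0.4). In the tree:
`hodgeConjectureFor_of_standardConjectureB_of_motivated_of_cupProduct` with the multiplicativity
theorem `Voisin2003_cupProduct_algebraicClasses_holds'`.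
[cite: Andre1996Motifs, §0.3 (pp. 7–8) and §2.1 remark following Déf. 1 (p. 14)] -/
theorem hodgeConjecture_of_hodgeIsMotivated_of_lefschetzStandard (hM : HodgeIsMotivated)
    (hB : LefschetzStandard) : _root_.HodgeConjecture :=
  fun _ _ hX =>
    hodgeConjectureFor_of_standardConjectureB_of_motivated_of_cupProduct
      Voisin2003_cupProduct_algebraicClasses_holds' hB hM hX

/-- **The summit as a conjunction of two named conjectures**:
`HodgeConjecture ↔ HodgeIsMotivated ∧ LefschetzStandard` — the Hodge conjecture for all smooth
projective complex varieties is equivalent to André's motivated Hodge conjecture together with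
Grothendieck's standard conjecture `B` (Lefschetz type), both for all smooth projective complex
varieties. [cite: Andre1996Motifs, §0.3 (pp. 7–8), §2.1 (p. 14) and §6.3 Remarque 2 (p. 33)]
[cite: Kleiman1968AlgebraicCycles, §2] -/
theorem hodgeConjecture_iff_hodgeIsMotivated_and_lefschetzStandard :
    _root_.HodgeConjecture ↔ HodgeIsMotivated ∧ LefschetzStandard :=
  ⟨fun h => ⟨hodgeIsMotivated_of_hodgeConjecture h, lefschetzStandard_of_hodgeConjecture h⟩,
    fun h => hodgeConjecture_of_hodgeIsMotivated_of_lefschetzStandard h.1 h.2⟩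

/-- **What `B` alone buys on abelian varieties** (André 1996, Thm. 0.6.2 with §6.3 Remarque 2): under
`LefschetzStandard`, André's theorem "Hodge classes on complex abelian varieties are motivated" — the
tree's named fact `Andre1996_hodgeClasses_abelianVariety_motivated`, carried here as a hypothesis —
gives the Hodge conjecture for every complex abelian variety.
[cite: Andre1996Motifs, Thm. 0.6.2 (p. 9) and §6.3 Remarque 2 (p. 33)] -/
theorem hodgeConjectureFor_abelianVariety_of_lefschetzStandard (hB : LefschetzStandard)
    (hA : Andre1996_hodgeClasses_abelianVariety_motivated) (A : AbelianVariety ℂ)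
    (hAsp : IsSmoothProjective A.dim A.X) : HodgeConjectureFor A.dim A.X :=
  (hodgeConjectureFor_iff_motivated_of_lefschetzStandard hB hAsp).mpr (hA A hAsp)

end Summit.HodgeConjecture.HodgeConjecture.Theorems.SoloBlind

end
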